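import Summits.CriticalPhenomena.PercolationContinuityZ3.Theses.PercBoundarySqueeze
import Literature.Probability.Percolation.LatticeSymmetry
import Literature.Probability.Percolation.RSW
import HarnessLib

/-!
# Route `PercBoundarySqueeze` — support `BoundaryArmCount` (item stmt-CriticalPhenomena-6985)

For every `R ≥ 1` (in fact for every `R`), at `p = p_c(ℤ³)`,

`Σ_{v ∈ ∂ⁱⁿΛ_R} P(∃ x ∈ Λ_{⌊R/2⌋}, v ↔ x inside Λ_R)
   ≤ 6 (2R+1)² · P(∃ y, (∃ i, ⌊R/2⌋ ≤ |y_i|) ∧ 0 ↔ y inside ℍ)`,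

`ℍ = {x | 0 ≤ x₀}`, `Λ_R = box 3 R`: lattice-symmetry bookkeeping (Zhang 2000; Cerf–Dembin 2020,
§2, (eq1); Grimmett 1999, §1.6, invariance of `P_p` under lattice automorphisms).

Proof. A site `v ∈ ∂ⁱⁿΛ_R` lies on a face `{x_i = ±R}` (`exists_eq_of_mem_innerBoundary_box`).
The lattice automorphism `ψ = σ ∘ (· - v)`, `σ` the signed coordinate permutation exchanging the
axes `i` and `0` with sign `∓` (`zdShiftIso`, `zdSignedPermIso`), maps `v ↦ 0`, the box `Λ_R`
into `ℍ`, and every `x ∈ Λ_{⌊R/2⌋}` to a site of height `R ∓ x_i ≥ R - ⌊R/2⌋ ≥ ⌊R/2⌋`;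
restricted connection events are transported along `ψ` (`relabel_mem_openConnIn`,
`openConnIn_mono`) and `P_p` is `ψ`-invariant (`bondPercolation_real_preimage_relabel_iso`),
which gives the per-vertex bound `percBoundarySqueeze_real_boundary_core_le` (the analogue of
`CerfDembinVanishing.measure_mem_boxCluster_le`). Summing, `|∂ⁱⁿΛ_R| ≤ 2·3·(2R+1)²`
(`card_innerBoundary_box_le`).
-/

noncomputable section

namespace Summit.CriticalPhenomena.PercolationContinuityZ3.Theorems

open MeasureTheory Literature.Probability.Percolation Literature.Probability.LatticeModels

/-- **Per-vertex symmetry bound.** For `v ∈ ∂ⁱⁿΛ_R` and any parameter `p`,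
`P_p(∃ x ∈ Λ_{⌊R/2⌋}, v ↔ x inside Λ_R) ≤ P_p(∃ y, (∃ i, ⌊R/2⌋ ≤ |y_i|) ∧ 0 ↔ y inside ℍ)`:
the image of the first event under the lattice automorphism `y ↦ σ(y - v)` (with `σ` the signed
coordinate permutation exchanging the axes `i` and `0`, `v` on the face `{x_i = ±R}`) lies in the
second, and `P_p` is invariant (Cerf–Dembin 2020, §2, (eq1), "using the symmetry of the lattice";
Grimmett 1999, §1.6). -/
theorem percBoundarySqueeze_real_boundary_core_le (p : unitInterval) (R : ℕ) {v : Site 3}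
    (hv : v ∈ innerBoundary (zdGraph 3) (box 3 R)) :
    (bondPercolation (zdGraph 3) p).real
        {ω | ∃ x ∈ box 3 (R / 2), ω ∈ openConnIn (↑(box 3 R) : Set (Site 3)) v x} ≤
      (bondPercolation (zdGraph 3) p).real
        {ω | ∃ y : Site 3, (∃ i : Fin 3, ((R / 2 : ℕ) : ℤ) ≤ |y i|) ∧
          ω ∈ openConnIn {x : Site 3 | 0 ≤ x 0} 0 y} := by
  obtain ⟨i, hi⟩ := exists_eq_of_mem_innerBoundary_box hv
  -- the sign of the reflection, with the two geometric facts it delivers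
  obtain ⟨s, hsbox, hscore⟩ : ∃ s : ℤˣ, (∀ y ∈ box 3 R, 0 ≤ (s : ℤ) * (y i - v i)) ∧
      ∀ x ∈ box 3 (R / 2), ((R / 2 : ℕ) : ℤ) ≤ (s : ℤ) * (x i - v i) := by
    rcases hi with hvi | hvi
    · refine ⟨-1, fun y hy => ?_, fun x hx => ?_⟩
      · have := (mem_box.1 hy i).2
        rw [hvi]; push_cast; linarith
      · have := (mem_box.1 hx i).2
        rw [hvi]; push_cast; omega
    · refine ⟨1, fun y hy => ?_, fun x hx => ?_⟩
      · have := (mem_box.1 hy i).1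
        rw [hvi]; push_cast; linarith
      · have := (mem_box.1 hx i).1
        rw [hvi]; push_cast; omega
  -- the automorphism `ψ y = σ (y - v)`
  set π : Equiv.Perm (Fin 3) := Equiv.swap i 0 with hπ
  set ψ : zdGraph 3 ≃g zdGraph 3 := (zdShiftIso (-v)).trans (zdSignedPermIso π fun _ => s) with hψ
  set e : Site 3 ≃ Site 3 := ψ.toEquiv with he
  have he_apply : ∀ y, e y = Site.signedPerm π (fun _ => s) (y + -v) := fun y => rfl
  have he0 : ∀ y, e y 0 = (s : ℤ) * (y i - v i) := fun y => by
    rw [he_apply, Site.signedPerm_apply, hπ, Equiv.symm_swap, Equiv.swap_apply_right]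
    simp [sub_eq_add_neg]
  have hev : e v = 0 := by rw [he_apply, add_neg_cancel, Site.signedPerm_zero]
  have himg : e '' (↑(box 3 R) : Set (Site 3)) ⊆ {x : Site 3 | 0 ≤ x 0} := by
    rintro _ ⟨y, hy, rfl⟩
    show 0 ≤ e y 0
    rw [he0]
    exact hsbox y hy
  -- the inclusion of events
  have hsub : {ω | ∃ x ∈ box 3 (R / 2), ω ∈ openConnIn (↑(box 3 R) : Set (Site 3)) v x} ⊆
      BondConfig.relabel (sym2Equiv e) ⁻¹'
        {ω | ∃ y : Site 3, (∃ i : Fin 3, ((R / 2 : ℕ) : ℤ) ≤ |y i|) ∧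
          ω ∈ openConnIn {x : Site 3 | 0 ≤ x 0} 0 y} := by
    rintro ω ⟨x, hx, hω⟩
    have h1 := relabel_mem_openConnIn e hω
    rw [hev] at h1
    refine ⟨e x, ⟨0, ?_⟩, openConnIn_mono himg _ _ h1⟩
    rw [he0]
    exact (hscore x hx).trans (le_abs_self _)
  calc (bondPercolation (zdGraph 3) p).real
        {ω | ∃ x ∈ box 3 (R / 2), ω ∈ openConnIn (↑(box 3 R) : Set (Site 3)) v x}
      ≤ (bondPercolation (zdGraph 3) p).real (BondConfig.relabel (sym2Equiv e) ⁻¹'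
          {ω | ∃ y : Site 3, (∃ i : Fin 3, ((R / 2 : ℕ) : ℤ) ≤ |y i|) ∧
            ω ∈ openConnIn {x : Site 3 | 0 ≤ x 0} 0 y}) :=
        measureReal_mono hsub (measure_ne_top _ _)
    _ = (bondPercolation (zdGraph 3) p).real
          {ω | ∃ y : Site 3, (∃ i : Fin 3, ((R / 2 : ℕ) : ℤ) ≤ |y i|) ∧
            ω ∈ openConnIn {x : Site 3 | 0 ≤ x 0} 0 y} := by
        rw [he, bondPercolation_real_preimage_relabel_iso ψ p]

/-- `|∂ⁱⁿΛ_R| ≤ 6 (2R+1)²` in `ℤ³` (the six faces of the cube; `card_innerBoundary_box_le` with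
`d = 3`), as a real inequality. -/
theorem percBoundarySqueeze_card_innerBoundary_box_three_le (R : ℕ) :
    ((innerBoundary (zdGraph 3) (box 3 R)).card : ℝ) ≤ 6 * (2 * (R : ℝ) + 1) ^ 2 := by
  have h : (innerBoundary (zdGraph 3) (box 3 R)).card ≤ 6 * (2 * R + 1) ^ 2 :=
    calc (innerBoundary (zdGraph 3) (box 3 R)).card ≤ 2 * 3 * (2 * R + 1) ^ (3 - 1) :=
          Literature.Probability.Percolation.card_innerBoundary_box_le (d := 3) R
      _ = 6 * (2 * R + 1) ^ 2 := by norm_num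
  exact_mod_cast h

/-- **Route `PercBoundarySqueeze`, support `BoundaryArmCount`** (item stmt-CriticalPhenomena-6985):
for `R ≥ 1`, at `p_c(ℤ³)`,
`Σ_{v ∈ ∂ⁱⁿΛ_R} P(v ↔ Λ_{⌊R/2⌋} inside Λ_R) ≤ 6(2R+1)² · P(∃ y, (∃ i, ⌊R/2⌋ ≤ |y_i|) ∧ 0 ↔ y inside ℍ)`
(Zhang 2000's boundary-arm count; Cerf–Dembin 2020, §2, (eq1); Grimmett 1999, §1.6). The
hypothesis `1 ≤ R` is not needed. -/
theorem boundaryArmCount_proof :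
    Summit.CriticalPhenomena.PercolationContinuityZ3.Theses.PercBoundarySqueeze.BoundaryArmCount := by
  intro R _
  set P := bondPercolation (zdGraph 3) (criticalProbI 3) with hP
  set B : Set (BondConfig (Site 3)) := {ω | ∃ y : Site 3, (∃ i : Fin 3, ((R / 2 : ℕ) : ℤ) ≤ |y i|) ∧
    ω ∈ openConnIn {x : Site 3 | 0 ≤ x 0} 0 y} with hB
  calc ∑ v ∈ innerBoundary (zdGraph 3) (box 3 R),
        P.real {ω | ∃ x ∈ box 3 (R / 2), ω ∈ openConnIn (↑(box 3 R) : Set (Site 3)) v x}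
      ≤ ∑ _v ∈ innerBoundary (zdGraph 3) (box 3 R), P.real B :=
        Finset.sum_le_sum fun v hv => percBoundarySqueeze_real_boundary_core_le _ R hv
    _ = (innerBoundary (zdGraph 3) (box 3 R)).card * P.real B := by
        rw [Finset.sum_const, nsmul_eq_mul]
    _ ≤ 6 * (2 * (R : ℝ) + 1) ^ 2 * P.real B :=
        mul_le_mul_of_nonneg_right (percBoundarySqueeze_card_innerBoundary_box_three_le R)
          measureReal_nonneg

end Summit.CriticalPhenomena.PercolationContinuityZ3.Theorems

end
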